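import Summits.ResolutionOfSingularities.ResolutionOfSingularities.Theorems.AQSHeightTwoPlusStalkPoint
import Summits.ResolutionOfSingularities.ResolutionOfSingularities.Theorems.AQSHeightTwoOrderReadOff
import Summits.ResolutionOfSingularities.ResolutionOfSingularities.Theorems.WeightedInvariantHypersurfaceLocalGameEFTPointMoveChart
import HarnessLib

/-!
# (o25) «F-AQS-T in the kernel», piece (γ2) — PLUS-STALK, EXACT READ-OFF: the order of the strict transform at a point of
# `B₊(U)` IS the order of the `t⁻¹`-primitive transform

Route `ResolutionOfSingularities/WeightedInvariant`, crux `Theses.WeightedInvariant.HypersurfaceCentreConstruction`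
(stmt-ResolutionOfSingularities-19897), door line `local-engine`, rung `e = 1`, ORDER (o25) of res-L1-w43-plan-1; the design memo's
literal (γ2) (res-type-092, `O25-DESIGN.md` §2 and (I4): «`idealOrder (R.cobordantStrictTransform U X) b = adicOrder (g/1)`»).  The
assembly `AbramovichQuekSchober2025_heightTwoCentre_holds` consumed the inequality `≤` (`AQSHeightTwoPlusStalkPoint.lean`); this sequel
proves the EQUALITY for a regular local base and a full regular system of parameters as chart germs:

* `iSup_colon_span_singleton_eq_span_of_prime` — in a domain, for `t` prime with `t ∤ g`: `⋃ₙ ((tᵃ g) : tⁿ) = (g)`;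
* `prime_algebraMap_localizationAtPrime`, `not_dvd_algebraMap_localizationAtPrime` — a prime element `t ∈ 𝔫` of a domain stays
  prime in `B_𝔫`, and `t ∤ g` persists;
* `prime_tInv_of_span_eq_maximalIdeal` — **`t⁻¹` is a prime element of the game ring `S[t⁻¹, 𝒥ₙ(x; w) tⁿ]`** when `S` is regular
  local and `x` is a regular system of parameters with positive weights (`B/(t⁻¹) ≅ κ[X₁, …, X_d]`, the tree's exceptional chart (K3a)
  `LocalGameEFTPointMove.rho`, kernel `(t⁻¹)`; Włodarczyk §2.3.9: the exceptional divisor of `B` is the weighted normal bundle);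
* **`ReesAlgebraData.IsWeightedChart.idealOrder_cobordantStrictTransform_eq_adicOrder`** — for `b : B₊(U)` over `η`, the game-side prime
  `𝔫` (with `t⁻¹ ∈ 𝔫 ⊇ 𝔪_η`, off the vertex) satisfies, for EVERY `t⁻¹`-primitive factorisation `f = (t⁻¹)ᵃ g` of the generator of
  `X_η`: `idealOrder (R.cobordantStrictTransform U X) b = adicOrder (g/1 ∈ (B_S)_𝔫)` (the `t⁻¹`-saturation of `(f)` in `(B_S)_𝔫` is
  `(g/1)`; read through `Ψ` with res-type-057's `idealOrder_eq_adicOrder_of_map_ringEquiv`).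

Def-free helper (`--supports stmt-ResolutionOfSingularities-19897`); OURS bookkeeping — nothing here is a claim about resolution of
singularities in positive characteristic or about the cited paper beyond its typed statement.  AI-written; weaker than expert review.
[cite: Wlodarczyk2022, §2.3.9; 3.3.12; Def. 5.1.1]
-/

noncomputable section

set_option linter.dupNamespace false -- mandated namespace of this single-conjunct summit

open CategoryTheory AlgebraicGeometry TopologicalSpace IsLocalRing
open scoped LaurentPolynomial
open LaurentPolynomial
open Literature.AlgebraicGeometry.Resolution
open Summit.ResolutionOfSingularities.ResolutionOfSingularities.Theorems
open Summit.ResolutionOfSingularities.ResolutionOfSingularities.Cruxes.HypersurfaceCentreConstruction.LocalEngine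

namespace Summit.ResolutionOfSingularities.ResolutionOfSingularities.Theorems.AQSHeightTwo

/-! ## Generic: saturations by a prime element, primes and non-divisibility under localisation -/

section Generic

/-- **In a domain, for a prime element `t` not dividing `g`: `⋃ₙ ((tᵃ g) : tⁿ) = (g)`** — the `t`-saturation of `(tᵃ g)` is generated by
the `t`-primitive part. [folklore] -/
theorem iSup_colon_span_singleton_eq_span_of_prime {O : Type*} [CommRing O] [IsDomain O] {t g : O} (ht : Prime t)
    (htg : ¬ t ∣ g) (a : ℕ) : (⨆ n : ℕ, (Ideal.span {t ^ a * g}).colon {t ^ n}) = Ideal.span {g} := by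
  -- `z tᵏ = c g ⇒ g ∣ z`, by induction on `k` (peel one `t` off `c` each time)
  have key : ∀ (k : ℕ) (z c : O), z * t ^ k = c * g → g ∣ z := by
    intro k
    induction k with
    | zero =>
      intro z c h
      rw [pow_zero, mul_one] at h
      exact ⟨c, by rw [h, mul_comm]⟩
    | succ k ih =>
      intro z c h
      have htc : t ∣ c * g := ⟨z * t ^ k, by rw [← h]; ring⟩
      obtain ⟨c₁, rfl⟩ := (ht.dvd_or_dvd htc).resolve_right htg
      refine ih z c₁ (mul_right_cancel₀ ht.ne_zero ?_)
      rw [mul_assoc, ← pow_succ, h]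
      ring
  apply le_antisymm
  · refine iSup_le fun n => ?_
    intro z hz
    rw [Submodule.mem_colon_singleton, smul_eq_mul, Ideal.mem_span_singleton'] at hz
    obtain ⟨c, hc⟩ := hz
    rw [Ideal.mem_span_singleton]
    exact key n z (c * t ^ a) (by rw [← hc]; ring)
  · rw [Ideal.span_singleton_le_iff_mem]
    exact mem_iSup_colon_of_mul_pow_mem _ _ _ a (by rw [mul_comm]; exact Ideal.mem_span_singleton_self _)

variable {B : Type*} [CommRing B] [IsDomain B]

/-- A prime element `t` of a domain lying in the prime `𝔫` stays prime in `B_𝔫`. [folklore] -/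
theorem prime_algebraMap_localizationAtPrime {t : B} (ht : Prime t) (𝔫 : Ideal B) [𝔫.IsPrime] (htn : t ∈ 𝔫) :
    Prime (algebraMap B (Localization.AtPrime 𝔫) t) := by
  have hI : (Ideal.span {t}).IsPrime := (Ideal.span_singleton_prime ht.ne_zero).mpr ht
  have hd : Disjoint (𝔫.primeCompl : Set B) ↑(Ideal.span {t}) := by
    rw [Set.disjoint_left]
    intro s hs hst
    exact hs ((Ideal.span_singleton_le_iff_mem _).mpr htn hst)
  have hP := IsLocalization.isPrime_of_isPrime_disjoint 𝔫.primeCompl (Localization.AtPrime 𝔫) (Ideal.span {t}) hI hd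
  rw [Ideal.map_span, Set.image_singleton] at hP
  have hne : algebraMap B (Localization.AtPrime 𝔫) t ≠ 0 := fun h =>
    ht.ne_zero (IsLocalization.injective (Localization.AtPrime 𝔫) 𝔫.primeCompl_le_nonZeroDivisors
      (by rw [h, map_zero]))
  exact (Ideal.span_singleton_prime hne).mp hP

/-- For a prime element `t ∈ 𝔫` of a domain: `t ∤ g` in `B` ⇒ `t/1 ∤ g/1` in `B_𝔫` (a denominator would be divisible by `t`,
hence in `𝔫`). [folklore] -/
theorem not_dvd_algebraMap_localizationAtPrime {t g : B} (ht : Prime t) (htg : ¬ t ∣ g) (𝔫 : Ideal B) [𝔫.IsPrime]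
    (htn : t ∈ 𝔫) : ¬ algebraMap B (Localization.AtPrime 𝔫) t ∣ algebraMap B (Localization.AtPrime 𝔫) g := by
  rintro ⟨y, hy⟩
  obtain ⟨⟨h, s⟩, rfl⟩ := IsLocalization.mk'_surjective 𝔫.primeCompl y
  -- clear the denominator: `g s = t h` in `B`
  have e : algebraMap B (Localization.AtPrime 𝔫) (g * s) = algebraMap B (Localization.AtPrime 𝔫) (t * h) := by
    rw [map_mul, map_mul, hy, mul_assoc, IsLocalization.mk'_spec]
  have e' : g * (s : B) = t * h := IsLocalization.injective (Localization.AtPrime 𝔫) 𝔫.primeCompl_le_nonZeroDivisors e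
  have hts : t ∣ g * (s : B) := ⟨h, e'⟩
  obtain ⟨c, hc⟩ := (ht.dvd_or_dvd hts).resolve_left htg
  exact s.2 (hc ▸ 𝔫.mul_mem_right c htn)

/-- **The exact read-off through a game-side model** (generic base ring): if `Ψ : 𝒪_{Y,b} ≃+* B_𝔫` carries the stalk `K_b` onto
the `t`-saturation of `J B_𝔫` with `J = (tᵃ g)`, `t ∈ 𝔫` a prime element of the domain `B` and `t ∤ g`, then `ord_b(K) = ord(g/1)`
(the saturation is `(g/1)`; res-type-057's `idealOrder_eq_adicOrder_of_map_ringEquiv`).  Stated with `B` generic so that the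
local-ring instances of `B_𝔫` are the ones synthesised from `B`'s. [cite: Wlodarczyk2022, 3.3.12] -/
theorem idealOrder_eq_adicOrder_of_map_eq_saturation {Y : Scheme.{0}} (K : Y.IdealSheafData) (b : Y)
    {B : Type} [CommRing B] [IsDomain B] (𝔫 : Ideal B) [𝔫.IsPrime]
    (Ψ : Y.presheaf.stalk b ≃+* Localization.AtPrime 𝔫) (J : Ideal B) {t g : B} (a : ℕ)
    (hΨ : (stalkIdeal K b).map (Ψ : Y.presheaf.stalk b →+* Localization.AtPrime 𝔫) =
      ⨆ n : ℕ, (J.map (algebraMap B (Localization.AtPrime 𝔫))).colon {algebraMap B (Localization.AtPrime 𝔫) t ^ n})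
    (hJ : J = Ideal.span {t ^ a * g}) (ht : Prime t) (htn : t ∈ 𝔫) (htg : ¬ t ∣ g) :
    idealOrder K b = adicOrder (algebraMap B (Localization.AtPrime 𝔫) g) := by
  subst hJ
  have hprime' := prime_algebraMap_localizationAtPrime ht 𝔫 htn
  have hndvd' := not_dvd_algebraMap_localizationAtPrime ht htg 𝔫 htn
  rw [ideal_map_span_singleton, map_mul, map_pow, iSup_colon_span_singleton_eq_span_of_prime hprime' hndvd' a] at hΨ
  exact idealOrder_eq_adicOrder_of_map_ringEquiv K b Ψ hΨ

end Generic

/-! ## `t⁻¹` is a prime element of the game ring of a regular system of parameters -/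

section PrimeT

variable {S : Type} [CommRing S] [IsRegularLocalRing S] {d : ℕ} (u : Fin d → S) (w : Fin d → ℕ)

/-- **`t⁻¹` is prime in `S[t⁻¹, 𝒥ₙ(u; w) tⁿ]`** for a regular local `S`, a regular system of parameters `u` (`(u) = 𝔪`,
`spanFinrank 𝔪 = d`) and positive weights: the exceptional fibre ring `B/(t⁻¹)` is the polynomial ring `κ[X₁, …, X_d]` over the
residue field (`LocalGameEFTPointMove.rho`, kernel `(t⁻¹)`), a domain. [cite: Wlodarczyk2022, §2.3.9] -/
theorem prime_tInv_of_span_eq_maximalIdeal (hu : Ideal.span (Set.range u) = maximalIdeal S)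
    (hd : (maximalIdeal S).spanFinrank = d) (hw : ∀ i, 0 < w i) :
    Prime (extReesAlgebra.tInv (weightedMonomialIdeal u w)) := by
  haveI := isDomain_of_isRegularLocalRing S
  have hmax : (Ideal.span (Set.range u)).IsMaximal := by
    rw [hu]
    exact IsLocalRing.maximalIdeal.isMaximal S
  haveI : (Ideal.span (Set.range u)).IsPrime := hmax.isPrime
  have h0 : extReesAlgebra.tInv (weightedMonomialIdeal u w) ≠ 0 := by
    intro h
    have h' := congrArg Subtype.val h
    rw [extReesAlgebra.coe_tInv, ZeroMemClass.coe_zero] at h'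
    exact (isUnit_T (R := S) (-1 : ℤ)).ne_zero h'
  have hprime : (Ideal.span {extReesAlgebra.tInv (weightedMonomialIdeal u w)}).IsPrime := by
    rw [← LocalGameEFTPointMove.ker_rho u w hu hd hw]
    exact RingHom.ker_isPrime _
  exact (Ideal.span_singleton_prime h0).mp hprime

end PrimeT

/-! ## The exact read-off on `B₊(U)` -/

section Rees

variable {Y : Scheme.{0}} (R : ReesAlgebraData Y) (U : Y.affineOpens)

/-- **(γ2) EXACT READ-OFF.**  `(U, u, w)` a weighted chart of `R` on `Y`, `η ∈ U` with `𝒪_{Y,η}` regular, the germs `x` of `u` a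
regular system of parameters of `𝒪_{Y,η}` (`(x) = 𝔪_η`, `spanFinrank 𝔪_η = m`), `X` an ideal sheaf with `X_η = (f)`.  Then for every
`b : B₊(U)` over `η` there is a prime `𝔫` of `B_S = 𝒪_{Y,η}[t⁻¹, 𝒥ₙ(x; w) tⁿ]` with `t⁻¹ ∈ 𝔫 ⊇ 𝔪_η B_S`, off the vertex, such that
for EVERY `t⁻¹`-primitive factorisation `f = (t⁻¹)ᵃ g` in `B_S`:
`idealOrder (R.cobordantStrictTransform U X) b = adicOrder (g/1 ∈ (B_S)_𝔫)` — the order of the strict transform at `b` is the order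
of the primitive transform `g` (the `t⁻¹`-saturation of `(f)` in `(B_S)_𝔫` is `(g/1)`, `t⁻¹/1` being prime there).
[cite: Wlodarczyk2022, §2.3.9; 3.3.12; Def. 5.1.1] -/
theorem _root_.Literature.AlgebraicGeometry.Resolution.ReesAlgebraData.IsWeightedChart.idealOrder_cobordantStrictTransform_eq_adicOrder
    {m : ℕ} {u : Fin m → Γ(Y, U)} {w : Fin m → ℕ} (hchart : R.IsWeightedChart U u w)
    {η : Y} (hη : η ∈ (U : Y.Opens)) [IsRegularLocalRing (Y.presheaf.stalk η)] {x : Fin m → Y.presheaf.stalk η}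
    (hx : ∀ i, (Y.presheaf.germ (U : Y.Opens) η hη).hom (u i) = x i)
    (hspan : Ideal.span (Set.range x) = maximalIdeal (Y.presheaf.stalk η))
    (hrk : (maximalIdeal (Y.presheaf.stalk η)).spanFinrank = m)
    (X : Y.IdealSheafData) {f : Y.presheaf.stalk η} (hf : stalkIdeal X η = Ideal.span {f})
    (b : R.cobordantPlus U) (hb : R.cobordantPlusι U b = η) :
    ∃ (𝔫 : Ideal (extReesAlgebra (weightedMonomialIdeal x w))) (_ : 𝔫.IsPrime),
      extReesAlgebra.tInv (weightedMonomialIdeal x w) ∈ 𝔫 ∧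
      (maximalIdeal (Y.presheaf.stalk η)).map
        (algebraMap (Y.presheaf.stalk η) (extReesAlgebra (weightedMonomialIdeal x w))) ≤ 𝔫 ∧
      ¬ extReesAlgebra.vertexIdeal (weightedMonomialIdeal x w) ≤ 𝔫 ∧
      ∀ (a : ℕ) (g : extReesAlgebra (weightedMonomialIdeal x w)),
        algebraMap (Y.presheaf.stalk η) (extReesAlgebra (weightedMonomialIdeal x w)) f =
          extReesAlgebra.tInv (weightedMonomialIdeal x w) ^ a * g →
        ¬ extReesAlgebra.tInv (weightedMonomialIdeal x w) ∣ g →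
        idealOrder (R.cobordantStrictTransform U X) b =
          adicOrder (algebraMap (extReesAlgebra (weightedMonomialIdeal x w)) (Localization.AtPrime 𝔫) g) := by
  -- the local model `A' := 𝒪_{Y,η}`
  letI : Algebra Γ(Y, U) (Y.presheaf.stalk η) := Y.presheaf.algebra_section_stalk (⟨η, hη⟩ : (U : Y.Opens))
  haveI : IsLocalization.AtPrime (Y.presheaf.stalk η) (U.2.primeIdealOf ⟨η, hη⟩).asIdeal :=
    U.2.isLocalization_stalk ⟨η, hη⟩
  haveI := isDomain_of_isRegularLocalRing (Y.presheaf.stalk η)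
  have halg : algebraMap Γ(Y, U) (Y.presheaf.stalk η) = (Y.presheaf.germ (U : Y.Opens) η hη).hom :=
    TopCat.Presheaf.stalk_open_algebraMap Y.presheaf ⟨η, hη⟩
  have hI' : ∀ n, weightedMonomialIdeal x w n = (R.chartIdeals U n).map (algebraMap Γ(Y, U) (Y.presheaf.stalk η)) := by
    intro n
    have hux : (fun i => algebraMap Γ(Y, U) (Y.presheaf.stalk η) (u i)) = x := funext fun i => by rw [halg]; exact hx i
    rw [← hux]
    exact hchart.weightedMonomialIdeal_map_eq R U n
  have hxm : ∀ i, x i ∈ maximalIdeal (Y.presheaf.stalk η) := fun i => hspan ▸ Ideal.subset_span ⟨i, rfl⟩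
  have hsupp : η ∈ R.support :=
    hchart.mem_support_of_forall_germ_mem R U hη fun i => by rw [hx i]; exact hxm i
  -- the game-side model of `𝒪_{B₊(U), b}`
  have hm := R.exists_gameSide_stalk_model_cobordantPlus U (hchart.chartIdeals_antitone R U) b η hη hb hI'
  obtain ⟨𝔫, h𝔫, Ψ, hΨ, hV, hM, hT⟩ := hm
  refine ⟨𝔫, h𝔫, hT hsupp, hM, hV, fun a g hfg hndvd => ?_⟩
  -- `t⁻¹` is prime in `B_S`; `X(U) B_S = (f) B_S = ((t⁻¹)ᵃ g)`
  have hprime := prime_tInv_of_span_eq_maximalIdeal x w hspan hrk hchart.w_pos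
  have h1 : (X.ideal U).map (algebraMap Γ(Y, U) (Y.presheaf.stalk η)) = Ideal.span {f} := by
    rw [halg, ← stalkIdeal_eq_map_germ X U hη, hf]
  have h2 : ((X.ideal U).map (algebraMap Γ(Y, U) (Y.presheaf.stalk η))).map
      (algebraMap (Y.presheaf.stalk η) (extReesAlgebra (weightedMonomialIdeal x w))) =
      Ideal.span {extReesAlgebra.tInv (weightedMonomialIdeal x w) ^ a * g} := by
    rw [h1, ideal_map_span_singleton, hfg]
  -- read through `Ψ` (generic-base lemma: the instances of `(B_S)_𝔫` are those synthesised from `B_S`)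
  exact idealOrder_eq_adicOrder_of_map_eq_saturation (R.cobordantStrictTransform U X) b 𝔫 Ψ _ a (hΨ X) h2 hprime
    (hT hsupp) hndvd

end Rees

end Summit.ResolutionOfSingularities.ResolutionOfSingularities.Theorems.AQSHeightTwo

end
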